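import Summits.QuantumFields.YangMills.Theorems.AllWindowsColdBoxBoxHighLineLogDetSecondOrder
import Literature.Analysis.InnerProduct.SchurInequality

/-!
# T-S5.7d input: the HILBERT–SCHMIDT form of the second-order expansion of `log |det (1 + X)|`
# (STUB-PLAN-S5-STEP2 §8 / planner ym-idea-2 g18 routing 2026-08-29T19:46:09Z (iii) `GhostTaylor`; LINE-19 S5 ⟨stmt-QuantumFields-24004⟩/⟨24335⟩)

Width seat `ym-line-sfw-p2-w3` (g40).  w2 g30's ✓T-S5.4r `logDetSecondOrder` bounds the Taylor remainder of the ghost loop by the CRUDE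
`2 n ρ³` (`n` = dimension, `ρ` = ℓ²-operator bound of `X`), which for the Faddeev–Popov perturbation `X = F₁⁻¹(F(U(a)) − F₁)` of the edge chart
(`n ≍ H⁴`, `ρ ≍ H² t`) gives `H¹⁰ t³` — too weak for T-S5.7d's `H⁶ (log)^m t³`.  This file proves the Hilbert–Schmidt form

  `|log |det (1 + X)| − tr X + tr (X²)/2| ≤ (2ρ/3) · Σ_{i,j} X_{ij}²`   (`0 ≤ ρ ≤ 1/2`, `‖Xv‖² ≤ ρ²‖v‖²` for all `v`),

for a real square matrix over ANY finite index type (`logDet_hs`): w2's spectral route (complexify; `det(1+X) = Π(1+λᵢ)`, `tr X = Σλᵢ`,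
`tr X² = Σλᵢ²`, `|λᵢ| ≤ ρ`, `‖log(1+z) − z + z²/2‖ ≤ ‖z‖³/(3(1−‖z‖))` — all ✓`LogDet.*`) with the one new input, SCHUR'S INEQUALITY
`Σ|λᵢ|² ≤ Σ|X_{ij}|²` (✓`Literature.Analysis.InnerProduct.matrix_sum_norm_sq_roots_charpoly_le`): `Σ‖λᵢ‖³ ≤ ρ Σ‖λᵢ‖² ≤ ρ ‖X‖_HS²`.
The `Fin n` statement (`logDet_hs_fin`) is transported to an arbitrary `Fintype` index by `Matrix.reindex` (`logDet_hs`).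

Everything proved, Mathlib + tree only, standard axioms; no definitions.  HONEST LABEL: a matrix-analysis input of ONE brick (7d) of STEP 2 of the
XL stub S5 of a critic-PASSed DRAFT line; 7d, S5, U5, ⟨24004⟩ ⟨24335⟩ ⟨24336⟩ remain OPEN; no crux, rung or summit is proved; **the Yang–Mills
mass gap is NOT proved by this file.**
-/

set_option autoImplicit false

noncomputable section

open Matrix Finset Polynomial

namespace Summit.QuantumFields.YangMills.Theorems.AllWindowsColdBoxBoxHighLine

namespace LogDetHS

open LogDet

variable {n : ℕ}

/-- Entrywise, the complexification has the same squared norms: `Σ ‖Y_{ij}‖² = Σ X_{ij}²`. -/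
theorem sum_norm_sq_map_ofReal {ι : Type*} [Fintype ι] (X : Matrix ι ι ℝ) :
    ∑ i, ∑ j, ‖(X.map ((↑) : ℝ → ℂ)) i j‖ ^ 2 = ∑ i, ∑ j, X i j ^ 2 := by
  refine Finset.sum_congr rfl fun i _ => Finset.sum_congr rfl fun j _ => ?_
  rw [Matrix.map_apply, Complex.norm_real, Real.norm_eq_abs, sq_abs]

/-- `‖log (1 + z) − z + z²/2‖ ≤ (2ρ/3) ‖z‖²` for `‖z‖ ≤ ρ ≤ 1/2` (the cubic Taylor remainder keeps two powers of `‖z‖`). -/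
theorem norm_log_sub_le_sq {z : ℂ} {ρ : ℝ} (hz : ‖z‖ ≤ ρ) (hρ : ρ ≤ 1 / 2) :
    ‖Complex.log (1 + z) - z + z ^ 2 / 2‖ ≤ 2 * ρ / 3 * ‖z‖ ^ 2 := by
  have hz1 : ‖z‖ < 1 := by linarith [norm_nonneg z]
  have h := Complex.norm_log_sub_logTaylor_le 2 hz1
  rw [logTaylor_three] at h
  have hrw : Complex.log (1 + z) - z + z ^ 2 / 2 = Complex.log (1 + z) - (z - z ^ 2 / 2) := by ring
  rw [hrw]
  refine h.trans ?_
  have h0 : 0 ≤ ‖z‖ := norm_nonneg z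
  have hinv : (1 - ‖z‖)⁻¹ ≤ 2 := by
    rw [inv_le_comm₀ (by linarith) (by norm_num)]; linarith
  have hρ0 : 0 ≤ ρ := h0.trans hz
  calc ‖z‖ ^ (2 + 1) * (1 - ‖z‖)⁻¹ / (2 + 1) = ‖z‖ ^ 2 * (‖z‖ * (1 - ‖z‖)⁻¹) / 3 := by ring
    _ ≤ ‖z‖ ^ 2 * (ρ * 2) / 3 := by gcongr
    _ = 2 * ρ / 3 * ‖z‖ ^ 2 := by ring

/-- **The Hilbert–Schmidt form on `Fin n`**: `|log |det (1 + X)| − tr X + tr(X²)/2| ≤ (2ρ/3) Σ X_{ij}²`. -/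
theorem logDet_hs_fin (X : Matrix (Fin n) (Fin n) ℝ) {ρ : ℝ} (h0 : 0 ≤ ρ) (h12 : ρ ≤ 1 / 2)
    (hX : ∀ v : Fin n → ℝ, X.mulVec v ⬝ᵥ X.mulVec v ≤ ρ ^ 2 * (v ⬝ᵥ v)) :
    (1 + X).det ≠ 0 ∧ |Real.log |(1 + X).det| - X.trace + (X * X).trace / 2| ≤ 2 * ρ / 3 * ∑ i, ∑ j, X i j ^ 2 := by
  have hdet : (1 + X).det ≠ 0 := det_one_add_ne_zero X h0 (by linarith) hX
  refine ⟨hdet, ?_⟩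
  set Y : Matrix (Fin n) (Fin n) ℂ := X.map ((↑) : ℝ → ℂ) with hY
  set μ : Multiset ℂ := Y.charpoly.roots with hμ
  have hbound : ∀ z ∈ μ, ‖z‖ ≤ ρ := fun z hz => norm_le_of_mem_roots_charpoly X h0 hX hz
  have hne : ∀ z ∈ μ, 1 + z ≠ 0 := by
    intro z hz h
    have : ‖z‖ = 1 := by rw [← norm_neg, show -z = 1 from by linear_combination -h, norm_one]
    linarith [hbound z hz]
  -- the three spectral identities (w2's `LogDet.*`)
  have hD : (((1 + X).det : ℝ) : ℂ) = (μ.map fun z => 1 + z).prod := by rw [← det_one_add_map, det_one_add_eq_prod_roots]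
  have hT1 : ((X.trace : ℝ) : ℂ) = μ.sum := by rw [← trace_map, Matrix.trace_eq_sum_roots_charpoly]
  have hT2 : (((X * X).trace : ℝ) : ℂ) = (μ.map fun z => z ^ 2).sum := by rw [← trace_map_sq, trace_sq_eq_sum_roots_sq]
  -- Schur's inequality
  have hSchur : (μ.map fun z => ‖z‖ ^ 2).sum ≤ ∑ i, ∑ j, X i j ^ 2 := by
    rw [← sum_norm_sq_map_ofReal X]
    exact Literature.Analysis.InnerProduct.matrix_sum_norm_sq_roots_charpoly_le Y
  -- `log |det (1 + X)| = Σ Re log (1 + λᵢ)`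
  have hlog : Real.log |(1 + X).det| = (μ.map fun z => (Complex.log (1 + z)).re).sum := by
    have h1 : |(1 + X).det| = ‖(((1 + X).det : ℝ) : ℂ)‖ := by rw [Complex.norm_real, Real.norm_eq_abs]
    rw [h1, hD]
    have h2 : ‖(μ.map fun z => 1 + z).prod‖ = ((μ.map fun z => 1 + z).map fun w => ‖w‖).prod := by
      have := map_multiset_prod (normHom : ℂ →*₀ ℝ) (μ.map fun z => 1 + z)
      simpa using this
    rw [h2, log_multiset_prod, Multiset.map_map, Multiset.map_map]
    · refine congrArg Multiset.sum (Multiset.map_congr rfl fun z _ => ?_)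
      simp [Complex.log_re]
    · intro x hx
      rw [Multiset.mem_map] at hx
      obtain ⟨w, hw, rfl⟩ := hx
      rw [Multiset.mem_map] at hw
      obtain ⟨z, hz, rfl⟩ := hw
      exact norm_ne_zero_iff.2 (hne z hz)
  set F : ℂ → ℂ := fun z => Complex.log (1 + z) - z + z ^ 2 / 2 with hF
  have hkey : Real.log |(1 + X).det| - X.trace + (X * X).trace / 2 = ((μ.map F).sum).re := by
    have hsum : (μ.map F).sum = (μ.map fun z => Complex.log (1 + z)).sum - μ.sum + (μ.map fun z => z ^ 2).sum * 2⁻¹ := by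
      simp only [hF, Multiset.sum_map_add, Multiset.sum_map_sub, Multiset.map_id', div_eq_mul_inv, Multiset.sum_map_mul_right]
    have hre : ((μ.map fun z => Complex.log (1 + z)).sum).re = (μ.map fun z => (Complex.log (1 + z)).re).sum := by
      have := map_multiset_sum Complex.reLm (μ.map fun z => Complex.log (1 + z))
      rw [Complex.reLm_coe, Multiset.map_map] at this
      exact this
    have h2 : ((μ.map fun z => z ^ 2).sum * 2⁻¹).re = (X * X).trace / 2 := by
      rw [← hT2, show (((X * X).trace : ℝ) : ℂ) * 2⁻¹ = (((X * X).trace / 2 : ℝ) : ℂ) by push_cast; ring, Complex.ofReal_re]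
    rw [hsum, Complex.add_re, Complex.sub_re, h2, hre, ← hlog, ← hT1, Complex.ofReal_re]
  rw [hkey]
  have hρ3 : 0 ≤ 2 * ρ / 3 := by positivity
  calc |((μ.map F).sum).re| ≤ ‖(μ.map F).sum‖ := Complex.abs_re_le_norm _
    _ ≤ ((μ.map F).map fun w => ‖w‖).sum := norm_multiset_sum_le _
    _ ≤ ((μ.map fun z => ‖z‖ ^ 2).map fun s => 2 * ρ / 3 * s).sum := by
        rw [Multiset.map_map, Multiset.map_map]
        refine Multiset.sum_map_le_sum_map _ _ fun z hz => ?_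
        exact norm_log_sub_le_sq (hbound z hz) h12
    _ = 2 * ρ / 3 * (μ.map fun z => ‖z‖ ^ 2).sum := by rw [Multiset.sum_map_mul_left, Multiset.map_id']
    _ ≤ 2 * ρ / 3 * ∑ i, ∑ j, X i j ^ 2 := mul_le_mul_of_nonneg_left hSchur hρ3

/-- **The Hilbert–Schmidt form, any finite index type**: for a real square matrix `X` with `‖Xv‖² ≤ ρ²‖v‖²` (`0 ≤ ρ ≤ 1/2`),
`det (1 + X) ≠ 0` and `|log |det (1 + X)| − tr X + tr(X·X)/2| ≤ (2ρ/3) · Σ_{i,j} X_{ij}²`. -/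
theorem logDet_hs {ι : Type*} [Fintype ι] [DecidableEq ι] (X : Matrix ι ι ℝ) {ρ : ℝ} (h0 : 0 ≤ ρ) (h12 : ρ ≤ 1 / 2)
    (hX : ∀ v : ι → ℝ, X.mulVec v ⬝ᵥ X.mulVec v ≤ ρ ^ 2 * (v ⬝ᵥ v)) :
    (1 + X).det ≠ 0 ∧ |Real.log |(1 + X).det| - X.trace + (X * X).trace / 2| ≤ 2 * ρ / 3 * ∑ i, ∑ j, X i j ^ 2 := by
  classical
  set e := Fintype.equivFin ι with he
  set X' : Matrix (Fin (Fintype.card ι)) (Fin (Fintype.card ι)) ℝ := Matrix.reindex e e X with hX'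
  -- transport of the hypotheses and of the four numbers
  have hX'v : ∀ v : Fin (Fintype.card ι) → ℝ, X'.mulVec v ⬝ᵥ X'.mulVec v ≤ ρ ^ 2 * (v ⬝ᵥ v) := by
    intro v
    have hmv : X' *ᵥ v = (X *ᵥ (v ∘ e)) ∘ e.symm := by
      rw [hX', Matrix.reindex_apply, Matrix.submatrix_mulVec_equiv, Equiv.symm_symm]
    have h1 : X' *ᵥ v ⬝ᵥ X' *ᵥ v = (X *ᵥ (v ∘ e)) ⬝ᵥ (X *ᵥ (v ∘ e)) := by
      rw [hmv]
      exact Equiv.sum_comp e.symm (fun i => (X *ᵥ (v ∘ e)) i * (X *ᵥ (v ∘ e)) i)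
    have h2 : v ⬝ᵥ v = (v ∘ e) ⬝ᵥ (v ∘ e) := by
      symm
      exact Equiv.sum_comp e (fun i => v i * v i)
    rw [h1, h2]
    exact hX (v ∘ e)
  have hdet : (1 + X').det = (1 + X).det := by
    have h1 : 1 + X' = Matrix.reindex e e (1 + X) := by
      ext i j
      simp only [hX', Matrix.reindex_apply, Matrix.add_apply, Matrix.submatrix_apply, Matrix.one_apply,
        Equiv.apply_eq_iff_eq]
    rw [h1, Matrix.det_reindex_self]
  have htr : X'.trace = X.trace := by
    rw [hX', Matrix.reindex_apply, Matrix.trace]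
    simp only [Matrix.diag_apply, Matrix.submatrix_apply]
    exact Equiv.sum_comp e.symm (fun i => X i i)
  have hmul : X' * X' = Matrix.reindex e e (X * X) := by
    rw [hX', Matrix.reindex_apply, Matrix.reindex_apply, Matrix.submatrix_mul_equiv]
  have htr2 : (X' * X').trace = (X * X).trace := by
    rw [hmul, Matrix.reindex_apply, Matrix.trace]
    simp only [Matrix.diag_apply, Matrix.submatrix_apply]
    exact Equiv.sum_comp e.symm (fun i => (X * X) i i)
  have hfro : ∑ i, ∑ j, X' i j ^ 2 = ∑ i, ∑ j, X i j ^ 2 := by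
    rw [hX', Matrix.reindex_apply]
    simp only [Matrix.submatrix_apply]
    rw [Equiv.sum_comp e.symm (fun i => ∑ j, X i (e.symm j) ^ 2)]
    exact Finset.sum_congr rfl fun i _ => Equiv.sum_comp e.symm (fun j => X i j ^ 2)
  have h := logDet_hs_fin X' h0 h12 hX'v
  rw [hdet, htr, htr2, hfro] at h
  exact h

end LogDetHS

end Summit.QuantumFields.YangMills.Theorems.AllWindowsColdBoxBoxHighLine

end
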